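import Summits.BirchSwinnertonDyer.Uniform.UI.O2HeightForm
import Literature.NumberTheory.EllipticCurves.SteinWuthrich2013.NonsplitMultCanonicalHolds
import HarnessLib

/-!
# Uniform/UI/O2 — the REGULATOR FORM of `TateSigmaIrrationalAtThree`

HONEST FRAMING (cell `bsd-uniform`, seat `ui-o2`, gen 4): THEOREMS ONLY about the CONJECTURE typed
in `Uniform/UI/O2.lean` (`TateSigmaIrrationalAtThree`, "C4", open, nothing asserted); no definition,
no new named fact, no `sorry`; nothing here proves BSD for any curve, books anything or moves a
census mark. The conjecture, STATED on SW's coordinates of ADMISSIBLE points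
(`Σ²_E(P) = C²σ_q(u(P))² ∉ ℚ`), is REWRITTEN as a statement about THE canonical `3`-adic height
pairing (the §4.2 datum `Dh`, `IsMultCanonical Dh q` — the object whose Gram determinant `Reg₃(E)`
the census certifies curve by curve). Write-up: `HOME/ui/O2-CONJECTURE.md` §9.

* pointwise dictionary: for ANY point `P = (x, y)`, `Σ²_E(P) ∈ ℚ ⟺ ĥ₃(P) ∈ log₃(ℚˣ)` (gen 3
  proved the global `iff`; per point it is pure `ker log₃ = ±3^ℤ` algebra, no admissibility);
* per curve, any rank (`forall_admissible_iff_pairing_self_notMem_ratSpan_log`): for ANY datum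
  `Dh` with `IsMultCanonical Dh q`, «`Σ²_E(P) ∉ ℚ` for every admissible `P`» ⟺ «`⟨P, P⟩₃ ∉
  ℚ·log₃(ℚˣ)` for every NON-TORSION `P ∈ E(ℚ)`», `ℚ·log₃(ℚˣ) = {c · log₃ s} =` the `ℚ`-span of
  `{log₃ ℓ : ℓ prime}` — admissibility disappears (`exists_admissible_nsmul_holds`,
  `⟨nP, nP⟩ = n²⟨P, P⟩` clears denominators) and the excluded set is a `ℚ`-SUBSPACE of `ℚ₃`;
* per curve, rank one (`forall_admissible_iff_padicRegulator_notMem_ratSpan_log`): «C4 on `E`» ⟺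
  «`Reg₃(E, Dh) ∉ ℚ·log₃(ℚˣ)`» — on pocket O2 (`r_an = 1`) the conjecture says EXACTLY that the
  census's certified number `Reg₃(E)` is not a rational multiple of the `3`-adic logarithm of a
  rational (Schneider's binder `Reg₃ ≠ 0` is the multiple `0`): a Baker-type statement;
* global: `pairing_self_ne_ratMul_padicLog_of_tateSigmaIrrational`,
  `padicRegulator_ne_ratMul_padicLog_of_tateSigmaIrrational`, and on the NON-SPLIT locus — where
  THE datum exists by the tree THEOREM `exists_isMultCanonical_holds` — the EQUIVALENCE
  `tateSigmaIrrational_nonsplit_iff_pairing_self_notMem_ratSpan_log`.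

CONDITIONAL statements remain conditional; nothing discharged. References: [SteinWuthrich2013]
§4.1 (4.1), §4.2; [Schneider1982PadicHeightI] §1; [MazurSteinTate2006] Conj. 1.1; [Bertrand1982]
p. 1 («vecteurs isotropes»), Cor. 4, Problème 1; [Iwasawa1972PadicL] §4.4 (`ker log_p`).
-/


noncomputable section

open scoped Classical

namespace Summit.BirchSwinnertonDyer.Uniform.UI.O2

open WeierstrassCurve Literature.NumberTheory.EllipticCurves
open Literature.NumberTheory.EllipticCurves.SteinWuthrich2013
open Literature.NumberTheory.EllipticCurves.Rank1Residual Summit.BirchSwinnertonDyer.Rank1Residual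

/-! ### `log₃` of powers of a non-zero `3`-adic number -/
/-- `log₃ a⁻¹ = − log₃ a` for `a ≠ 0` (`padicLog_mul_holds`). [cite: Iwasawa1972PadicL, §4.4] -/
theorem padicLog_inv_three {a : ℚ_[3]} (ha : a ≠ 0) : padicLog 3 a⁻¹ = -padicLog 3 a := by
  have h := padicLog_mul_holds 3 (x := a) (y := a⁻¹) ha (inv_ne_zero ha)
  rw [mul_inv_cancel₀ ha, padicLog_three_one] at h
  linear_combination -h

/-- `log₃ (a ^ k) = k · log₃ a` for `a ≠ 0`, `k : ℕ`. [cite: Iwasawa1972PadicL, §4.4] -/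
theorem padicLog_pow_three {a : ℚ_[3]} (ha : a ≠ 0) (k : ℕ) :
    padicLog 3 (a ^ k) = (k : ℚ_[3]) * padicLog 3 a := by
  induction k with
  | zero => rw [pow_zero, padicLog_three_one, Nat.cast_zero, zero_mul]
  | succ k ih =>
    rw [pow_succ, padicLog_mul_holds 3 (pow_ne_zero k ha) ha, ih]
    push_cast
    ring

/-- `log₃ (a ^ n) = n · log₃ a` for `a ≠ 0`, `n : ℤ`. [cite: Iwasawa1972PadicL, §4.4] -/
theorem padicLog_zpow_three {a : ℚ_[3]} (ha : a ≠ 0) (n : ℤ) :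
    padicLog 3 (a ^ n) = (n : ℚ_[3]) * padicLog 3 a := by
  cases n with
  | ofNat k =>
    rw [Int.ofNat_eq_natCast, zpow_natCast, padicLog_pow_three ha k]
    push_cast
    ring
  | negSucc k =>
    rw [zpow_negSucc, padicLog_inv_three (pow_ne_zero _ ha), padicLog_pow_three ha]
    push_cast
    ring

/-! ### Pointwise dictionary: `Σ²_E(P) ∈ ℚ ⟺ ĥ₃(P) ∈ log₃(ℚˣ)` (any point, no admissibility) -/

/-- **Pointwise (height ⟹ sigma).** If `ĥ₃(P) = log₃ s` (`s ∈ ℚˣ`) for a point `P = (x, y)`, then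
`Σ²_E(P) ∈ ℚ`: either `Σ² = 0`, or `log₃ Σ² = log₃ (den x / s)` and the rational kernel of `log₃`
applies. Pure algebra, any `W`, `q`, `P`. [cite: SteinWuthrich2013, §4.1 eq. (4.1)]
[cite: Iwasawa1972PadicL, §4.4] -/
theorem exists_rat_tateSigmaValueSq_eq_of_heightFourOneCoord_eq_padicLog (W : WeierstrassCurve ℚ)
    (q : ℚ_[3]) (x y : ℚ) {s : ℚ} (hs : s ≠ 0)
    (h : heightFourOneCoord W 3 q x y = padicLog 3 (s : ℚ_[3])) :
    ∃ r : ℚ, tateSigmaValueSq W 3 q x y = (r : ℚ_[3]) := by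
  by_cases hb : tateSigmaValueSq W 3 q x y = 0
  · exact ⟨0, by rw [hb, Rat.cast_zero]⟩
  have hden : (x.den : ℚ) ≠ 0 := by exact_mod_cast x.den_nz
  have hden3 : ((x.den : ℚ) : ℚ_[3]) ≠ 0 := by exact_mod_cast x.den_nz
  rw [heightFourOneCoord_eq] at h
  have hlog : padicLog 3 (tateSigmaValueSq W 3 q x y) =
      padicLog 3 (((x.den : ℚ) / s : ℚ) : ℚ_[3]) := by
    have hds : (((x.den : ℚ) / s : ℚ) : ℚ_[3]) = ((x.den : ℚ) : ℚ_[3]) * (s : ℚ_[3])⁻¹ := by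
      push_cast
      ring
    rw [hds, padicLog_div_ratCast hden3 hs]
    linear_combination -h
  exact exists_ratCast_eq_of_padicLog_eq_padicLog_ratCast hb (div_ne_zero hden hs) hlog

/-- **Pointwise (sigma ⟹ height).** If `Σ²_E(P) = r ∈ ℚ` for a point `P = (x, y)`, then
`ĥ₃(P) = log₃ (den x / r)` (`r ≠ 0`), resp. `log₃ (den x)` (`r = 0`, junk `log₃ 0 = 0`).
[cite: SteinWuthrich2013, §4.1 eq. (4.1)] [cite: Iwasawa1972PadicL, §4.4] -/
theorem exists_heightFourOneCoord_eq_padicLog_of_tateSigmaValueSq_eq_ratCast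
    (W : WeierstrassCurve ℚ) (q : ℚ_[3]) (x y : ℚ) {r : ℚ}
    (h : tateSigmaValueSq W 3 q x y = (r : ℚ_[3])) :
    ∃ s : ℚ, s ≠ 0 ∧ heightFourOneCoord W 3 q x y = padicLog 3 (s : ℚ_[3]) := by
  have hden : (x.den : ℚ) ≠ 0 := by exact_mod_cast x.den_nz
  have hden3 : ((x.den : ℚ) : ℚ_[3]) ≠ 0 := by exact_mod_cast x.den_nz
  by_cases hr : r = 0
  · refine ⟨x.den, hden, ?_⟩
    rw [heightFourOneCoord_eq, h, hr, Rat.cast_zero, padicLog_zero, sub_zero]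
  · refine ⟨(x.den : ℚ) / r, div_ne_zero hden hr, ?_⟩
    have hds : (((x.den : ℚ) / r : ℚ) : ℚ_[3]) = ((x.den : ℚ) : ℚ_[3]) * (r : ℚ_[3])⁻¹ := by
      push_cast
      ring
    rw [heightFourOneCoord_eq, h, hds, padicLog_div_ratCast hden3 hr]

/-- **Pointwise dictionary.** For any point `P = (x, y)`: `Σ²_E(P) ∈ ℚ` iff
`ĥ₃(P) ∈ log₃(ℚˣ)`. [cite: SteinWuthrich2013, §4.1 eq. (4.1)] [cite: Iwasawa1972PadicL, §4.4] -/
theorem tateSigmaValueSq_mem_rat_iff_heightFourOneCoord_mem_log_rat (W : WeierstrassCurve ℚ)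
    (q : ℚ_[3]) (x y : ℚ) :
    (∃ r : ℚ, tateSigmaValueSq W 3 q x y = (r : ℚ_[3])) ↔
      ∃ s : ℚ, s ≠ 0 ∧ heightFourOneCoord W 3 q x y = padicLog 3 (s : ℚ_[3]) :=
  ⟨fun ⟨_, hr⟩ ↦ exists_heightFourOneCoord_eq_padicLog_of_tateSigmaValueSq_eq_ratCast W q x y hr,
    fun ⟨_, hs, h⟩ ↦ exists_rat_tateSigmaValueSq_eq_of_heightFourOneCoord_eq_padicLog W q x y hs h⟩

/-! ### Per curve, any rank: C4 on `E` ⟺ `⟨P, P⟩₃ ∉ ℚ·log₃(ℚˣ)` on all non-torsion `P` -/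

section PerCurve
variable {W : WeierstrassCurve ℚ}

/-- `⟨nP, nP⟩ = n² ⟨P, P⟩` for a bilinear pairing. [folklore] -/
theorem pairing_nsmul_nsmul (Dh : PAdicHeightData W 3) (n : ℕ) (P : W.toAffine.Point) :
    Dh.pairing (n • P) (n • P) = ((n : ℚ_[3]) ^ 2) * Dh.pairing P P := by
  simp only [map_nsmul, AddMonoidHom.nsmul_apply, nsmul_eq_mul]
  ring

/-- `⟨kP, kP⟩ = k² ⟨P, P⟩` for a bilinear pairing, `k : ℤ`. [folklore] -/
theorem pairing_zsmul_zsmul (Dh : PAdicHeightData W 3) (k : ℤ) (P : W.toAffine.Point) :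
    Dh.pairing (k • P) (k • P) = ((k : ℚ_[3]) ^ 2) * Dh.pairing P P := by
  simp only [map_zsmul, AddMonoidHom.zsmul_apply, zsmul_eq_mul]
  ring

/-- **Per curve (sigma ⟹ span form), any rank.** For `W` globally minimal, `q ∈ ℚ₃`, `Dh` with
`IsMultCanonical Dh q`: if `Σ²_E(Q) ∉ ℚ` for EVERY admissible `Q`, then `⟨P, P⟩ ≠ c · log₃ s` for
every NON-TORSION `P`, `c ∈ ℚ`, `s ∈ ℚˣ`. (With `c = a/b`: some `Q = m·bP` is admissible,
`exists_admissible_nsmul_holds`; `⟨Q, Q⟩ = m²b²(a/b) log₃ s = log₃ (s^{m²ab})`, so `Σ²_E(Q) ∈ ℚ` by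
the pointwise dictionary.) [cite: SteinWuthrich2013, §4.2] [cite: Bertrand1982, p. 1, Cor. 4] -/
theorem pairing_self_ne_ratMul_padicLog_of_forall_admissible [W.IsElliptic] [W.IsGloballyMinimal]
    {q : ℚ_[3]}
    (HW : ∀ (x y : ℚ) (h : W.toAffine.Nonsingular x y), W.IsAdmissible 3 (.some x y h) →
      ∀ r : ℚ, tateSigmaValueSq W 3 q x y ≠ (r : ℚ_[3]))
    {Dh : PAdicHeightData W 3} (hDh : IsMultCanonical Dh q)
    {P : W.toAffine.Point} (hP : ¬ IsOfFinAddOrder P) {c s : ℚ} (hs : s ≠ 0) :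
    Dh.pairing P P ≠ (c : ℚ_[3]) * padicLog 3 (s : ℚ_[3]) := by
  intro hc
  -- `bP` is non-torsion (`b = c.den ≥ 1`)
  have hbP : ¬ IsOfFinAddOrder (c.den • P) := fun htor ↦ hP (htor.of_nsmul c.den_nz)
  obtain ⟨m, hm0, hadm⟩ := exists_admissible_nsmul_holds W 3 (c.den • P) hbP
  -- `Q = m • (c.den • P) = (m * c.den) • P`
  have hQ : m • (c.den • P) = (m * c.den) • P := (mul_nsmul' P m c.den).symm
  have hs3 : (s : ℚ_[3]) ≠ 0 := by exact_mod_cast hs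
  -- `⟨Q, Q⟩ = (m c.den)² · c · log₃ s = (m² · c.den · c.num) · log₃ s = log₃ (s ^ N)`
  set N : ℤ := (m : ℤ) ^ 2 * c.den * c.num with hN
  have hcnum : ((c.den : ℚ) : ℚ_[3]) * (c : ℚ_[3]) = ((c.num : ℚ) : ℚ_[3]) := by
    rw [← Rat.cast_mul, mul_comm, Rat.mul_den_eq_num]
  have hQQ : Dh.pairing (m • (c.den • P)) (m • (c.den • P)) =
      padicLog 3 (((s ^ N : ℚ)) : ℚ_[3]) := by
    rw [hQ, pairing_nsmul_nsmul, hc, Rat.cast_zpow, padicLog_zpow_three hs3 N, hN]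
    push_cast
    have : ((c.den : ℚ_[3])) * (c : ℚ_[3]) = ((c.num : ℤ) : ℚ_[3]) := by exact_mod_cast hcnum
    linear_combination ((m : ℚ_[3]) ^ 2 * (c.den : ℚ_[3]) * padicLog 3 (s : ℚ_[3])) * this
  -- destructure the admissible point `Q`
  rcases hQpt : m • (c.den • P) with _ | ⟨xQ, yQ, hQns⟩
  · rw [hQpt] at hadm
    exact hadm.1 IsOfFinAddOrder.zero
  · rw [hQpt] at hadm hQQ
    have hcan : Dh.pairing (.some xQ yQ hQns) (.some xQ yQ hQns) = heightFourOneCoord W 3 q xQ yQ :=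
      hDh _ hadm
    rw [hcan] at hQQ
    obtain ⟨r, hr⟩ := exists_rat_tateSigmaValueSq_eq_of_heightFourOneCoord_eq_padicLog W q xQ yQ
      (zpow_ne_zero N hs) hQQ
    exact HW xQ yQ hQns hadm r hr

/-- **Per curve (span form ⟹ sigma), any rank.** If for SOME datum `Dh` with `IsMultCanonical Dh q`
every non-torsion `P` has `⟨P, P⟩ ∉ ℚ·log₃(ℚˣ)`, then `Σ²_E(Q) ∉ ℚ` for every admissible `Q`
(`⟨Q, Q⟩ = ĥ₃(Q)` and `Σ² = r` would give `ĥ₃(Q) = 1 · log₃ s`). [cite: SteinWuthrich2013, §4.2] -/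
theorem forall_admissible_of_pairing_self_ne_ratMul_padicLog {q : ℚ_[3]} {Dh : PAdicHeightData W 3}
    (hDh : IsMultCanonical Dh q)
    (H : ∀ P : W.toAffine.Point, ¬ IsOfFinAddOrder P → ∀ c s : ℚ, s ≠ 0 →
      Dh.pairing P P ≠ (c : ℚ_[3]) * padicLog 3 (s : ℚ_[3]))
    (x y : ℚ) (h : W.toAffine.Nonsingular x y) (hadm : W.IsAdmissible 3 (.some x y h)) (r : ℚ) :
    tateSigmaValueSq W 3 q x y ≠ (r : ℚ_[3]) := by
  intro hr
  obtain ⟨s, hs, hlog⟩ :=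
    exists_heightFourOneCoord_eq_padicLog_of_tateSigmaValueSq_eq_ratCast W q x y hr
  refine H _ hadm.1 1 s hs ?_
  rw [hDh _ hadm, Rat.cast_one, one_mul]
  exact hlog

/-- **Per curve, any rank: EQUIVALENCE.** For `W` globally minimal, `q ∈ ℚ₃`, ANY datum `Dh` with
`IsMultCanonical Dh q`: «`Σ²_E(Q) ∉ ℚ` for every admissible `Q`» ⟺ «`⟨P, P⟩ ∉ ℚ·log₃(ℚˣ)` for every
non-torsion `P`» — a statement about the height form on `E(ℚ)/tors` and a `ℚ`-subspace of `ℚ₃`.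
[cite: SteinWuthrich2013, §4.2] [cite: MazurSteinTate2006, Conj. 1.1] [cite: Bertrand1982, p. 1] -/
theorem forall_admissible_iff_pairing_self_notMem_ratSpan_log [W.IsElliptic] [W.IsGloballyMinimal]
    {q : ℚ_[3]}
    {Dh : PAdicHeightData W 3} (hDh : IsMultCanonical Dh q) :
    (∀ (x y : ℚ) (h : W.toAffine.Nonsingular x y), W.IsAdmissible 3 (.some x y h) →
      ∀ r : ℚ, tateSigmaValueSq W 3 q x y ≠ (r : ℚ_[3])) ↔
    (∀ P : W.toAffine.Point, ¬ IsOfFinAddOrder P → ∀ c s : ℚ, s ≠ 0 →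
      Dh.pairing P P ≠ (c : ℚ_[3]) * padicLog 3 (s : ℚ_[3])) :=
  ⟨fun HW _ hP _ _ hs ↦ pairing_self_ne_ratMul_padicLog_of_forall_admissible HW hDh hP hs,
    fun H x y h hadm r ↦ forall_admissible_of_pairing_self_ne_ratMul_padicLog hDh H x y h hadm r⟩

/-! ### Per curve, rank one: C4 on `E` ⟺ `Reg₃(E) ∉ ℚ·log₃(ℚˣ)` -/

/-- In Mordell–Weil rank one, with basis `{P₀}`: `Reg₃(E, Dh) = ⟨P₀, P₀⟩`, `P₀` non-torsion, and
every `P ∈ E(ℚ)` is `k·P₀` modulo torsion, whence `⟨P, P⟩ = k² Reg₃`. (Rank-one Gram determinant;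
the span half of `IsMordellWeilBasis`.) [folklore] -/
theorem exists_generator_of_rank_one [W.IsElliptic] (hr : W.mordellWeilRank = 1)
    (Dh : PAdicHeightData W 3) :
    ∃ P₀ : W.toAffine.Point, ¬ IsOfFinAddOrder P₀ ∧ padicRegulator Dh = Dh.pairing P₀ P₀ ∧
      ∀ P : W.toAffine.Point, ∃ k : ℤ, Dh.pairing P P = ((k : ℚ_[3]) ^ 2) * Dh.pairing P₀ P₀ ∧
        (k = 0 → IsOfFinAddOrder P) := by
  -- adapted from `schneider_of_tateSigmaIrrational_of_rank_one` (gen 2)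
  obtain ⟨B, hB⟩ := W.exists_isMordellWeilBasis_holds
  have hcard : Fintype.card (Fin W.mordellWeilRank) = 1 := by rw [Fintype.card_fin, hr]
  let k₀ : Fin W.mordellWeilRank := ⟨0, by omega⟩
  have hall : ∀ i : Fin W.mordellWeilRank, i = k₀ := by
    intro i
    apply Fin.ext
    have hi := i.isLt
    show i.val = 0
    omega
  have hRegp : padicRegulator Dh = Dh.pairing (B k₀) (B k₀) := by
    rw [← padicRegulatorOf_eq_padicRegulator_holds Dh hB, padicRegulatorOf]
    convert Matrix.det_eq_elem_of_card_eq_one (A := Dh.pairingMatrix B) hcard k₀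
    rfl
  have hBk : ¬ IsOfFinAddOrder (B k₀) := by
    intro htor
    apply hB.1.ne_zero k₀
    -- `mordellWeilModTorsion` is elaborated with the classical `DecidableEq ℚ` (tree convention)
    letI : DecidableEq ℚ := fun a b ↦ Classical.propDecidable (a = b)
    simp only [Function.comp_apply]
    exact (QuotientAddGroup.eq_zero_iff _).mpr ((AddCommGroup.mem_torsion _).mpr (by convert htor))
  refine ⟨B k₀, hBk, hRegp, fun P ↦ ?_⟩
  -- the span half of the basis: `P - k • B k₀` is torsion for some `k : ℤ`
  obtain ⟨k, hT⟩ : ∃ k : ℤ, IsOfFinAddOrder (P - k • B k₀) := by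
    letI : DecidableEq ℚ := fun a b ↦ Classical.propDecidable (a = b)
    have hmem : (QuotientAddGroup.mk P : mordellWeilModTorsion W) ∈
        Submodule.span ℤ (Set.range (QuotientAddGroup.mk ∘ B : _ → mordellWeilModTorsion W)) := by
      rw [hB.2]
      exact Submodule.mem_top
    obtain ⟨f, hf⟩ := (Submodule.mem_span_range_iff_exists_fun ℤ).1 hmem
    have hsum : ∑ i, f i • (QuotientAddGroup.mk ∘ B : _ → mordellWeilModTorsion W) i =
        f k₀ • (QuotientAddGroup.mk (B k₀) : mordellWeilModTorsion W) := by
      rw [Finset.sum_eq_single k₀ (fun i _ hi ↦ absurd (hall i) hi)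
        (fun hk ↦ absurd (Finset.mem_univ _) hk)]
      rfl
    rw [hsum] at hf
    refine ⟨f k₀, ?_⟩
    have h0 : (QuotientAddGroup.mk (P - f k₀ • B k₀) : mordellWeilModTorsion W) = 0 := by
      rw [QuotientAddGroup.mk_sub, QuotientAddGroup.mk_zsmul, hf, sub_self]
    have hT' := (AddCommGroup.mem_torsion _).mp ((QuotientAddGroup.eq_zero_iff _).mp h0)
    convert hT'
  refine ⟨k, ?_, fun hk0 ↦ ?_⟩
  · -- `⟨P, P⟩ = ⟨kB + T, kB + T⟩ = k²⟨B, B⟩`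
    have hP : P = k • B k₀ + (P - k • B k₀) := by abel
    have h1 : Dh.pairing (P - k • B k₀) P = 0 := Dh.map_torsion _ _ hT
    have h2 : Dh.pairing (k • B k₀) (P - k • B k₀) = 0 := Dh.map_torsion_right _ _ hT
    calc Dh.pairing P P = Dh.pairing (k • B k₀ + (P - k • B k₀)) P := by rw [← hP]
      _ = Dh.pairing (k • B k₀) P := by rw [map_add, AddMonoidHom.add_apply, h1, add_zero]
      _ = Dh.pairing (k • B k₀) (k • B k₀ + (P - k • B k₀)) := by rw [← hP]
      _ = Dh.pairing (k • B k₀) (k • B k₀) := by rw [map_add, h2, add_zero]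
      _ = ((k : ℚ_[3]) ^ 2) * Dh.pairing (B k₀) (B k₀) := pairing_zsmul_zsmul Dh k (B k₀)
  · rw [hk0, zero_zsmul, sub_zero] at hT
    exact hT

/-- **Per curve, rank one (sigma ⟹ regulator form).** In Mordell–Weil rank one, with `Dh`
mult-canonical: if `Σ²_E(Q) ∉ ℚ` for every admissible `Q`, then `Reg₃(E, Dh) ≠ c · log₃ s` for all
`c ∈ ℚ`, `s ∈ ℚˣ` (`Reg₃ = ⟨P₀, P₀⟩`, `P₀` non-torsion; Schneider's `Reg₃ ≠ 0` is `c = 0`).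
[cite: Schneider1982PadicHeightI, §1] [cite: SteinWuthrich2013, §4.2, Conj. 4.1] -/
theorem padicRegulator_ne_ratMul_padicLog_of_forall_admissible [W.IsElliptic] [W.IsGloballyMinimal]
    (hr : W.mordellWeilRank = 1)
    {q : ℚ_[3]}
    (HW : ∀ (x y : ℚ) (h : W.toAffine.Nonsingular x y), W.IsAdmissible 3 (.some x y h) →
      ∀ r : ℚ, tateSigmaValueSq W 3 q x y ≠ (r : ℚ_[3]))
    {Dh : PAdicHeightData W 3} (hDh : IsMultCanonical Dh q) {c s : ℚ} (hs : s ≠ 0) :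
    padicRegulator Dh ≠ (c : ℚ_[3]) * padicLog 3 (s : ℚ_[3]) := by
  obtain ⟨P₀, hP₀, hReg, -⟩ := exists_generator_of_rank_one hr Dh
  rw [hReg]
  exact pairing_self_ne_ratMul_padicLog_of_forall_admissible HW hDh hP₀ hs

/-- **Per curve, rank one (regulator form ⟹ sigma).** If `Reg₃(E, Dh) ∉ ℚ·log₃(ℚˣ)` (`Dh`
mult-canonical, rank one), then `Σ²_E(Q) ∉ ℚ` for every admissible `Q` (`⟨Q, Q⟩ = k² Reg₃`, `k ≠ 0`,
and `ĥ₃(Q) = log₃ s` would give `Reg₃ = k⁻² log₃ s`). [cite: SteinWuthrich2013, §4.2] -/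
theorem forall_admissible_of_padicRegulator_ne_ratMul_padicLog [W.IsElliptic]
    (hr : W.mordellWeilRank = 1)
    {q : ℚ_[3]} {Dh : PAdicHeightData W 3} (hDh : IsMultCanonical Dh q)
    (H : ∀ c s : ℚ, s ≠ 0 → padicRegulator Dh ≠ (c : ℚ_[3]) * padicLog 3 (s : ℚ_[3]))
    (x y : ℚ) (h : W.toAffine.Nonsingular x y) (hadm : W.IsAdmissible 3 (.some x y h)) (r : ℚ) :
    tateSigmaValueSq W 3 q x y ≠ (r : ℚ_[3]) := by
  intro hr'
  obtain ⟨s, hs, hlog⟩ :=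
    exists_heightFourOneCoord_eq_padicLog_of_tateSigmaValueSq_eq_ratCast W q x y hr'
  obtain ⟨P₀, -, hReg, hgen⟩ := exists_generator_of_rank_one hr Dh
  obtain ⟨k, hk, hk0⟩ := hgen (.some x y h)
  have hkne : k ≠ 0 := fun h0 ↦ hadm.1 (hk0 h0)
  have hk3 : (k : ℚ_[3]) ≠ 0 := by exact_mod_cast hkne
  have hQQ : Dh.pairing (.some x y h) (.some x y h) = padicLog 3 (s : ℚ_[3]) := by
    rw [hDh _ hadm]
    exact hlog
  -- `Reg₃ = k⁻² log₃ s`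
  refine H ((1 : ℚ) / (k : ℚ) ^ 2) s hs ?_
  rw [hReg]
  have hkk : ((k : ℚ_[3]) ^ 2) * Dh.pairing P₀ P₀ = padicLog 3 (s : ℚ_[3]) := by rw [← hk, hQQ]
  have hk2 : ((k : ℚ_[3]) ^ 2) ≠ 0 := pow_ne_zero 2 hk3
  push_cast
  field_simp
  linear_combination hkk

/-- **Per curve, rank one: EQUIVALENCE — the REGULATOR FORM.** For `W` globally minimal of
Mordell–Weil rank one, `q ∈ ℚ₃`, and ANY datum `Dh` with `IsMultCanonical Dh q`:
«`Σ²_E(Q) ∉ ℚ` for every admissible `Q ∈ E(ℚ)`» ⟺ «`Reg₃(E, Dh) ∉ ℚ·log₃(ℚˣ)`», i.e. the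
conjecture on a rank-one curve says exactly that its canonical `3`-adic regulator is not a rational
multiple of the `3`-adic logarithm of a rational number. (On pocket O2, `r_an = 1`, this is the
Diophantine property of the ONE number per curve that the census certifies non-zero.)
[cite: Schneider1982PadicHeightI, §1] [cite: SteinWuthrich2013, §4.2, Conj. 4.1]
[cite: MazurSteinTate2006, Conj. 1.1] [cite: Bertrand1982, Cor. 4, Problème 1] -/
theorem forall_admissible_iff_padicRegulator_notMem_ratSpan_log [W.IsElliptic] [W.IsGloballyMinimal]
    (hr : W.mordellWeilRank = 1)
    {q : ℚ_[3]} {Dh : PAdicHeightData W 3} (hDh : IsMultCanonical Dh q) :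
    (∀ (x y : ℚ) (h : W.toAffine.Nonsingular x y), W.IsAdmissible 3 (.some x y h) →
      ∀ r : ℚ, tateSigmaValueSq W 3 q x y ≠ (r : ℚ_[3])) ↔
    (∀ c s : ℚ, s ≠ 0 → padicRegulator Dh ≠ (c : ℚ_[3]) * padicLog 3 (s : ℚ_[3])) :=
  ⟨fun HW _ _ hs ↦ padicRegulator_ne_ratMul_padicLog_of_forall_admissible hr HW hDh hs,
    fun H x y h hadm r ↦ forall_admissible_of_padicRegulator_ne_ratMul_padicLog hr hDh H x y h hadm r⟩

end PerCurve

/-! ### Global forms -/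
/-- **C4 ⟹ span form, every curve.** Under `TateSigmaIrrationalAtThree`: for `W` multiplicative at
`3`, Tate parameter `q`, `Dh` with `IsMultCanonical Dh q`, every non-torsion `P` has
`⟨P, P⟩ ∉ ℚ·log₃(ℚˣ)` (gen 2's anisotropy `pairing_self_ne_zero_of_tateSigmaIrrational` is `c = 0`).
[cite: SteinWuthrich2013, §4.2] [cite: Bertrand1982, p. 1, Cor. 4] -/
theorem pairing_self_ne_ratMul_padicLog_of_tateSigmaIrrational (hC : TateSigmaIrrationalAtThree)
    (W : WeierstrassCurve ℚ) [W.IsElliptic] [W.IsGloballyMinimal] (hmult : Mult W 3)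
    {q : ℚ_[3]} (hq0 : q ≠ 0) (hq1 : ‖q‖ < 1) (hj : tateJ q = (W.j : ℚ_[3]))
    {Dh : PAdicHeightData W 3} (hDh : IsMultCanonical Dh q)
    {P : W.toAffine.Point} (hP : ¬ IsOfFinAddOrder P) {c s : ℚ} (hs : s ≠ 0) :
    Dh.pairing P P ≠ (c : ℚ_[3]) * padicLog 3 (s : ℚ_[3]) := by
  have h' := hC
  unfold TateSigmaIrrationalAtThree at h'
  exact pairing_self_ne_ratMul_padicLog_of_forall_admissible (h' W hmult q hq0 hq1 hj) hDh hP hs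

/-- **C4 ⟹ REGULATOR FORM in rank one.** Under `TateSigmaIrrationalAtThree`: for `W` of Mordell–Weil
rank one multiplicative at `3`, `q`, `Dh` mult-canonical: `Reg₃(E, Dh) ≠ c · log₃ s` for all `c ∈ ℚ`,
`s ∈ ℚˣ` (gen 2's `schneider_of_tateSigmaIrrational_of_rank_one` is `c = 0`).
[cite: Schneider1982PadicHeightI, §1] [cite: SteinWuthrich2013, §4.2, Conj. 4.1] -/
theorem padicRegulator_ne_ratMul_padicLog_of_tateSigmaIrrational (hC : TateSigmaIrrationalAtThree)
    (W : WeierstrassCurve ℚ) [W.IsElliptic] [W.IsGloballyMinimal] (hmult : Mult W 3)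
    (hr : W.mordellWeilRank = 1)
    {q : ℚ_[3]} (hq0 : q ≠ 0) (hq1 : ‖q‖ < 1) (hj : tateJ q = (W.j : ℚ_[3]))
    {Dh : PAdicHeightData W 3} (hDh : IsMultCanonical Dh q) {c s : ℚ} (hs : s ≠ 0) :
    padicRegulator Dh ≠ (c : ℚ_[3]) * padicLog 3 (s : ℚ_[3]) := by
  have h' := hC
  unfold TateSigmaIrrationalAtThree at h'
  exact padicRegulator_ne_ratMul_padicLog_of_forall_admissible hr (h' W hmult q hq0 hq1 hj) hDh hs

/-- **EQUIVALENCE on the non-split locus** (O2's lever-locus reduction type; THE datum exists there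
by the tree THEOREM `exists_isMultCanonical_holds`, used in `←`): the NON-SPLIT instances of
`TateSigmaIrrationalAtThree` hold iff for every such `W`, Tate parameter `q`, `Dh` with
`IsMultCanonical Dh q` and non-torsion `P`, `⟨P, P⟩ ∉ ℚ·log₃(ℚˣ)`.
[cite: SteinWuthrich2013, §4.2 (pp. 15–16)] [cite: Bertrand1982, p. 1, Cor. 4, Problème 1] -/
theorem tateSigmaIrrational_nonsplit_iff_pairing_self_notMem_ratSpan_log :
    (∀ (W : WeierstrassCurve ℚ) [W.IsElliptic] [W.IsGloballyMinimal], Mult W 3 →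
      ¬ W.HasSplitMultiplicativeReductionAtPrime 3 →
      ∀ (q : ℚ_[3]), q ≠ 0 → ‖q‖ < 1 → tateJ q = (W.j : ℚ_[3]) →
      ∀ (x y : ℚ) (h : W.toAffine.Nonsingular x y), W.IsAdmissible 3 (.some x y h) →
        ∀ r : ℚ, tateSigmaValueSq W 3 q x y ≠ (r : ℚ_[3])) ↔
    (∀ (W : WeierstrassCurve ℚ) [W.IsElliptic] [W.IsGloballyMinimal], Mult W 3 →
      ¬ W.HasSplitMultiplicativeReductionAtPrime 3 →
      ∀ (q : ℚ_[3]), q ≠ 0 → ‖q‖ < 1 → tateJ q = (W.j : ℚ_[3]) →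
      ∀ (Dh : PAdicHeightData W 3), IsMultCanonical Dh q →
      ∀ P : W.toAffine.Point, ¬ IsOfFinAddOrder P → ∀ c s : ℚ, s ≠ 0 →
        Dh.pairing P P ≠ (c : ℚ_[3]) * padicLog 3 (s : ℚ_[3])) := by
  constructor
  · intro H W _ _ hmult hns q hq0 hq1 hj Dh hDh P hP c s hs
    exact pairing_self_ne_ratMul_padicLog_of_forall_admissible (H W hmult hns q hq0 hq1 hj) hDh hP hs
  · intro H W _ _ hmult hns q hq0 hq1 hj x y h hadm r
    obtain ⟨Dh, hDh⟩ := exists_isMultCanonical_holds W 3 (by norm_num) hmult hns q hq0 hq1 hj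
    exact forall_admissible_of_pairing_self_ne_ratMul_padicLog hDh (H W hmult hns q hq0 hq1 hj Dh hDh)
      x y h hadm r

end Summit.BirchSwinnertonDyer.Uniform.UI.O2

end
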